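import Summits.ResolutionOfSingularities.ResolutionOfSingularities.Theorems.EquisingularLiftEquisingularLiftNatLinearCentreKill
import HarnessLib

/-!
# [OURS · L1 W4.5(b) · EL♮(3) · T23-A⁗ (F4)] HYPERPLANE LETTERS OVER `O`, part 1 — the graded surjection with LINEAR values on the
# killed variables (`x_a ↦ ℓ_a(y)`), its kernel, and its base change to the special fibre

res-type-027 g19 (FREE NAMED-RESERVE prover of chain w45b; res-L1-w45b-stub-4's `T23A4-ENGINE-WORD-v2-DRAFT.md` §3 (L1) «HYPERPLANE
INFRASTRUCTURE over a ring … res-type-027», my feasibility word `L/res-type-027/g19/F4-FEASIBILITY.md` 8a547123c3effec5, deliverable (H1)).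
Crux `EquisingularLiftNatThree` = stmt-ResolutionOfSingularities-20148 (parent stmt-…-20038), route `EquisingularLift`, line `sections`.
OURS; NOT a statement of any manuscript ([Hironaka2017] is a candidate under adjudication, nothing of it is asserted); AI-written, weaker than
expert review. No `sorry`, no definition, no instance; standard axioms. `--supports stmt-ResolutionOfSingularities-20148 --as helper`.

WHAT. res-D-pv-013's R1 file `…NatLinearCentreKill` (p505223) carries the COORDINATE linear subspace `V(x_a : a ∉ range e) ⊂ ℙᴺ_O` as
`ker (Proj f)` for the graded surjection `f : O[x₀..x_N] → O[y₀..y_r]`, `f (X (e j)) = X j`, `f (X a) = 0` (`a ∉ range e`). A GENERAL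
hyperplane `V₊(ℓ̃)`, `ℓ̃ = Σ cⱼ xⱼ` with ONE unit coefficient `c_a`, is the same object for the surjection with `f (X a) := −c_a⁻¹ Σ_j c_{e j} y_j`
(a LINEAR FORM instead of `0`); more generally this file lets every killed variable go to a linear form: the hypothesis
`hf0 : f (X a) = 0` of R1 is weakened to `hf1 : (f (X a)).IsHomogeneous 1`, and over `π : O → k` the two substitutions are tied by
`hfkv : f_k (X a) = map π (f_O (X a))`. Everything of R1 part 1 survives line for line (the R1 lemmas that never used `hf0` —
`kill_rename`, `irrelevant_le_map_kill`, `kill_eq_aeval`, `awayMap_algebraMap_kill`, `projMap_kill_comp_structureMap`, and in part 2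
`isClosedImmersion_projMap_kill`, `isRegular_kerSubscheme`, `flat_kerSubschemeι_comp(_id)`, `range_projMap_eq_specialFibre` — are simply
CALLED on the new `f`):
* `exists_subst_ringHom` / `exists_subst` — the substitution exists (for a value vector `v` with `v (e j) = X j`), as a graded homomorphism with
  the `Proj.map` hypothesis; `subst_surjective`;
* `ker_subst` — **`ker f = (X a − rename e (f (X a)) : a ∉ range e)`**; `ker_subst_of_compl_eq_singleton` (one killed variable: principal);
* `isHomogeneous_subst`; `map_comp_subst`, `exists_ker_lift_subst` (coefficient map `π : O → k`);
* ★ `ker_projMap_subst_eq_comap` — **`ker (Proj f_k) = ker (Proj f_O) · 𝒪_{ℙ_k}`** along the special fibre `g = Proj (map π)` (R1's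
  `ker_projMap_kill_eq_comap`, Hartshorne II Prop. 5.9 / Ex. 3.12 on the charts `D₊(x_i)`);
* `preimage_support_subst` (`g⁻¹ supp Λ = supp Λ_k`), `image_support_subset_nonGeneric_subst` (off the generic point of `Y = (ι ≫ g)(H)` as
  soon as one point of `H` is off `supp Λ_k`) — R1 part 2's `preimage_support` / `image_support_subset_nonGeneric`.
Part 2 (`…NatHyperplaneLetter`): the `TCPlus.LetterDatum` of a hyperplane letter at the initial stage.

References: [Hartshorne1977, II Prop. 5.9, Ex. 3.12 (a)]; R1 files `…NatLinearCentreKill` / `…NatLinearCentre` (OURS, imported).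
-/

set_option linter.dupNamespace false -- mandated namespace `Summit.<Summit>.<Problem>` of this single-conjunct summit

noncomputable section

open CategoryTheory CategoryTheory.Limits AlgebraicGeometry TopologicalSpace
open MvPolynomial HomogeneousLocalization
open Literature.AlgebraicGeometry.Resolution
open AlgebraicGeometry.Scheme.IdealSheafData
open Summit.ResolutionOfSingularities.ResolutionOfSingularities.Cruxes.EquisingularLift.StrataSplit

attribute [local instance] MvPolynomial.gradedAlgebra

namespace Summit.ResolutionOfSingularities.ResolutionOfSingularities.Cruxes.EquisingularLiftNat

namespace LinearLetter

universe u

/-! ## Algebra of the graded surjection with linear values on the killed variables -/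

section Subst

variable {R : Type u} [CommRing R] {N r : ℕ} (e : Fin (r + 1) → Fin (N + 1))
  (f : MvPolynomial (Fin (N + 1)) R →+* MvPolynomial (Fin (r + 1)) R)
  (hfC : ∀ a : R, f (C a) = C a) (hfe : ∀ j : Fin (r + 1), f (X (e j)) = X j)

/-- **The substitution exists** (ring homomorphism) with prescribed values `v i` on the variables, `v (e j) = X j`. [folklore] -/
theorem exists_subst_ringHom (v : Fin (N + 1) → MvPolynomial (Fin (r + 1)) R) (hv : ∀ j, v (e j) = X j) :
    ∃ f : MvPolynomial (Fin (N + 1)) R →+* MvPolynomial (Fin (r + 1)) R,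
      (∀ a : R, f (C a) = C a) ∧ (∀ j : Fin (r + 1), f (X (e j)) = X j) ∧ ∀ i : Fin (N + 1), f (X i) = v i :=
  ⟨(aeval v).toRingHom, fun a => by simp, fun j => by simp [hv j], fun i => by simp⟩

/-- The substitution is surjective (`rename e` is a section, R1 `LinearCentre.kill_rename`). [folklore] -/
theorem subst_surjective (hfC' : ∀ a : R, f (C a) = C a) (hfe' : ∀ j : Fin (r + 1), f (X (e j)) = X j) :
    Function.Surjective f :=
  fun q => ⟨_, EquisingularLiftNat.LinearCentre.kill_rename e f hfC' hfe' q⟩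

include hfC hfe in
/-- **The kernel of the substitution is the ideal of the linear forms `X a − rename e (f (X a))`, `a ∉ range e`**: the composite
`rename e ∘ f` is the identity modulo that ideal (checked on `C` and on the variables), so `q − rename e (f q)` lies in it for every `q`.
[folklore] -/
theorem ker_subst : RingHom.ker f = Ideal.span ((fun i : Fin (N + 1) => X i - rename e (f (X i))) '' (Set.range e)ᶜ) := by
  set J : Ideal (MvPolynomial (Fin (N + 1)) R) :=
    Ideal.span ((fun i : Fin (N + 1) => X i - rename e (f (X i))) '' (Set.range e)ᶜ) with hJ
  refine le_antisymm ?_ (Ideal.span_le.mpr ?_)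
  · have hcomp : (Ideal.Quotient.mk J).comp
          ((rename e : MvPolynomial (Fin (r + 1)) R →ₐ[R] _).toRingHom.comp f) = Ideal.Quotient.mk J := by
      refine MvPolynomial.ringHom_ext (fun a => ?_) (fun i => ?_)
      · simp only [RingHom.coe_comp, Function.comp_apply, AlgHom.toRingHom_eq_coe, RingHom.coe_coe]
        rw [hfC, rename_C]
      · simp only [RingHom.coe_comp, Function.comp_apply, AlgHom.toRingHom_eq_coe, RingHom.coe_coe]
        by_cases hi : i ∈ Set.range e
        · obtain ⟨j, rfl⟩ := hi
          rw [hfe, rename_X]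
        · rw [Ideal.Quotient.eq, ← neg_sub, Ideal.neg_mem_iff]
          exact Ideal.subset_span ⟨i, hi, rfl⟩
    intro q hq
    have h := congrArg (fun g : MvPolynomial (Fin (N + 1)) R →+* _ => g q) hcomp
    simp only [RingHom.coe_comp, Function.comp_apply, AlgHom.toRingHom_eq_coe, RingHom.coe_coe] at h
    rw [RingHom.mem_ker] at hq
    rw [hq, map_zero, map_zero] at h
    exact Ideal.Quotient.eq_zero_iff_mem.mp h.symm
  · rintro _ ⟨i, -, rfl⟩
    rw [SetLike.mem_coe, RingHom.mem_ker, map_sub, EquisingularLiftNat.LinearCentre.kill_rename e f hfC hfe, sub_self]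

include hfC hfe in
/-- One killed variable `a` (a HYPERPLANE): `ker f = (X a − rename e (f (X a)))` is principal. [folklore] -/
theorem ker_subst_of_compl_eq_singleton {a : Fin (N + 1)} (ha : (Set.range e)ᶜ = {a}) :
    RingHom.ker f = Ideal.span {X a - rename e (f (X a))} := by
  rw [ker_subst e f hfC hfe, ha, Set.image_singleton]

include hfC hfe in
/-- The substitution preserves homogeneity (every variable goes to a variable or to a linear form). [folklore] -/
theorem isHomogeneous_subst (hf1 : ∀ i : Fin (N + 1), i ∉ Set.range e → (f (X i)).IsHomogeneous 1)
    {q : MvPolynomial (Fin (N + 1)) R} {n : ℕ} (hq : q.IsHomogeneous n) : (f q).IsHomogeneous n := by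
  rw [EquisingularLiftNat.LinearCentre.kill_eq_aeval f hfC]
  have h1 := hq.aeval (fun i : Fin (N + 1) => f (X i)) (n := 1) (fun i => by
    by_cases hi : i ∈ Set.range e
    · obtain ⟨j, rfl⟩ := hi
      rw [hfe]
      exact isHomogeneous_X R _
    · exact hf1 i hi)
  rw [one_mul] at h1
  exact h1

/-- **The substitution as a graded homomorphism, with the `Proj.map` hypothesis** — existence for a value vector `v` with `v (e j) = X j`
and `v a` a linear form (`a ∉ range e`); def-free. [folklore] -/
theorem exists_subst (v : Fin (N + 1) → MvPolynomial (Fin (r + 1)) R) (hv : ∀ j, v (e j) = X j)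
    (hv1 : ∀ i : Fin (N + 1), i ∉ Set.range e → (v i).IsHomogeneous 1) :
    ∃ (g : homogeneousSubmodule (Fin (N + 1)) R →+*ᵍ homogeneousSubmodule (Fin (r + 1)) R)
      (_ : HomogeneousIdeal.irrelevant (homogeneousSubmodule (Fin (r + 1)) R) ≤
        (HomogeneousIdeal.irrelevant (homogeneousSubmodule (Fin (N + 1)) R)).map g),
      (∀ a : R, g (C a) = C a) ∧ (∀ j : Fin (r + 1), g (X (e j)) = X j) ∧ ∀ i : Fin (N + 1), g (X i) = v i := by
  obtain ⟨f, hfC, hfe, hfv⟩ := exists_subst_ringHom e v hv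
  have hf1 : ∀ i : Fin (N + 1), i ∉ Set.range e → (f (X i)).IsHomogeneous 1 := fun i hi => by
    rw [hfv]; exact hv1 i hi
  let g : homogeneousSubmodule (Fin (N + 1)) R →+*ᵍ homogeneousSubmodule (Fin (r + 1)) R :=
    ⟨f, fun h => isHomogeneous_subst e f hfC hfe hf1 h⟩
  exact ⟨g, EquisingularLiftNat.LinearCentre.irrelevant_le_map_kill e f hfe g (fun _ => rfl), hfC, hfe, hfv⟩

end Subst

/-! ## Base change of the substitution along `π : O → k` -/

section Square

variable {O k : Type u} [CommRing O] [CommRing k] (π : O →+* k) {N r : ℕ} (e : Fin (r + 1) → Fin (N + 1))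
  (fO : MvPolynomial (Fin (N + 1)) O →+* MvPolynomial (Fin (r + 1)) O)
  (hfOC : ∀ a : O, fO (C a) = C a) (hfOe : ∀ j : Fin (r + 1), fO (X (e j)) = X j)
  (fk : MvPolynomial (Fin (N + 1)) k →+* MvPolynomial (Fin (r + 1)) k)
  (hfkC : ∀ a : k, fk (C a) = C a) (hfke : ∀ j : Fin (r + 1), fk (X (e j)) = X j)

include hfOC hfOe hfkC hfke in
/-- The substitutions over `O` and `k` commute with `π` (the `k`-values are the `π`-images of the `O`-values). [folklore] -/
theorem map_comp_subst (hfkv : ∀ i : Fin (N + 1), i ∉ Set.range e → fk (X i) = MvPolynomial.map π (fO (X i))) :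
    (MvPolynomial.map π).comp fO = fk.comp (MvPolynomial.map π) := by
  refine MvPolynomial.ringHom_ext (fun a => ?_) (fun i => ?_)
  · simp only [RingHom.coe_comp, Function.comp_apply]
    rw [hfOC, map_C, map_C, hfkC]
  · simp only [RingHom.coe_comp, Function.comp_apply]
    rw [map_X]
    by_cases hi : i ∈ Set.range e
    · obtain ⟨j, rfl⟩ := hi
      rw [hfOe, hfke, map_X]
    · rw [hfkv i hi]

include hfOC hfOe hfkC hfke in
/-- **Kernel elements lift**: a homogeneous element of `ker f_k` lifts along a surjective `π` to a homogeneous element of `ker f_O` of the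
same degree (lift arbitrarily, then subtract the renamed substitution). [folklore] -/
theorem exists_ker_lift_subst (hfO1 : ∀ i : Fin (N + 1), i ∉ Set.range e → (fO (X i)).IsHomogeneous 1)
    (hfkv : ∀ i : Fin (N + 1), i ∉ Set.range e → fk (X i) = MvPolynomial.map π (fO (X i)))
    (hπ : Function.Surjective π) {n : ℕ} (a : MvPolynomial (Fin (N + 1)) k)
    (ha : a.IsHomogeneous n) (hak : fk a = 0) :
    ∃ b : MvPolynomial (Fin (N + 1)) O, b.IsHomogeneous n ∧ fO b = 0 ∧ MvPolynomial.map π b = a := by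
  obtain ⟨b, hb, hba⟩ :=
    Summit.ResolutionOfSingularities.ResolutionOfSingularities.Cruxes.EquisingularLift.StrataSplit.LinearCentre.exists_homogeneous_lift
      π hπ a ha
  refine ⟨b - rename e (fO b), ?_, ?_, ?_⟩
  · exact hb.sub ((isHomogeneous_subst e fO hfOC hfOe hfO1 hb).rename_isHomogeneous)
  · rw [map_sub, EquisingularLiftNat.LinearCentre.kill_rename e fO hfOC hfOe, sub_self]
  · rw [map_sub, hba, map_rename, sub_eq_self]
    have h := congrArg (fun g : MvPolynomial (Fin (N + 1)) O →+* _ => g b)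
      (map_comp_subst π e fO hfOC hfOe fk hfkC hfke hfkv)
    simp only [RingHom.coe_comp, Function.comp_apply] at h
    rw [h, hba, hak, map_zero]

end Square

/-! ## The kernel ideal sheaf: base change to the special fibre -/

section Comap

variable {O k : Type} [CommRing O] [CommRing k] (π : O →+* k) (hπ : Function.Surjective π) {N r : ℕ}
  (e : Fin (r + 1) → Fin (N + 1))
  (φ : (homogeneousSubmodule (Fin (N + 1)) O) →+*ᵍ (homogeneousSubmodule (Fin (N + 1)) k))
  (hφ : ∀ q, φ q = MvPolynomial.map π q)
  (hφ' : HomogeneousIdeal.irrelevant (homogeneousSubmodule (Fin (N + 1)) k) ≤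
    (HomogeneousIdeal.irrelevant (homogeneousSubmodule (Fin (N + 1)) O)).map φ)
  (fO : (homogeneousSubmodule (Fin (N + 1)) O) →+*ᵍ (homogeneousSubmodule (Fin (r + 1)) O))
  (hfO' : HomogeneousIdeal.irrelevant (homogeneousSubmodule (Fin (r + 1)) O) ≤
    (HomogeneousIdeal.irrelevant (homogeneousSubmodule (Fin (N + 1)) O)).map fO)
  (hfOC : ∀ a : O, fO (C a) = C a) (hfOe : ∀ j : Fin (r + 1), fO (X (e j)) = X j)
  (fk : (homogeneousSubmodule (Fin (N + 1)) k) →+*ᵍ (homogeneousSubmodule (Fin (r + 1)) k))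
  (hfk' : HomogeneousIdeal.irrelevant (homogeneousSubmodule (Fin (r + 1)) k) ≤
    (HomogeneousIdeal.irrelevant (homogeneousSubmodule (Fin (N + 1)) k)).map fk)
  (hfkC : ∀ a : k, fk (C a) = C a) (hfke : ∀ j : Fin (r + 1), fk (X (e j)) = X j)

include hφ hfOC hfOe hfkC hfke hπ in
/-- ★ **The `O`-hyperplane restricts to the `k`-hyperplane on the special fibre**: for the closed immersion `g = Proj φ : ℙ^N_k → ℙ^N_O`
(`φ` the coefficient map of a surjection `π : O → k`) and the substitutions `f_O`, `f_k` with `π`-compatible linear values, the inverse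
image ideal sheaf of `ker (Proj f_O)` along `g` is `ker (Proj f_k)`. (`≤`: `Proj f_k ≫ g = Proj φ_r ≫ Proj f_O`; `≥`: over the chart
`D₊(x_i)` the ideal `(ker f_k)_{(x_i)}` is spanned by fractions `a/x_iⁿ`, `a ∈ ker f_k` homogeneous, which lift to `ker f_O`.) R1's
`LinearCentre.ker_projMap_kill_eq_comap` with `hf0` weakened to linear values. [cite: Hartshorne1977, II Prop. 5.9 and Ex. 3.12 (a)] -/
theorem ker_projMap_subst_eq_comap
    (hfO1 : ∀ i : Fin (N + 1), i ∉ Set.range e → (fO (X i) : MvPolynomial (Fin (r + 1)) O).IsHomogeneous 1)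
    (hfkv : ∀ i : Fin (N + 1), i ∉ Set.range e → (fk (X i) : MvPolynomial (Fin (r + 1)) k) = MvPolynomial.map π (fO (X i))) :
    (Proj.map fk hfk').ker = (Proj.map fO hfO').ker.comap (Proj.map φ hφ') := by
  classical
  refine Eq.symm ?_
  -- the coefficient map on the small projective space
  let φr : (homogeneousSubmodule (Fin (r + 1)) O) →+*ᵍ (homogeneousSubmodule (Fin (r + 1)) k) :=
    ⟨MvPolynomial.map π, fun h ↦ h.map π⟩
  have hφr : ∀ q, φr q = MvPolynomial.map π q := fun _ ↦ rfl
  have hφr' := ProjectiveAmbientFibre.irrelevant_le_map_gradedMap π φr hφr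
  have hsq : fk.comp φ = φr.comp fO := by
    have hc := map_comp_subst π e fO.toRingHom (fun a => hfOC a) (fun j => hfOe j)
      fk.toRingHom (fun a => hfkC a) (fun j => hfke j) (fun i hi => hfkv i hi)
    refine GradedRingHom.ext fun q => ?_
    have h := congrArg (fun ψ : MvPolynomial (Fin (N + 1)) O →+* MvPolynomial (Fin (r + 1)) k => ψ q) hc
    simp only [RingHom.coe_comp, Function.comp_apply] at h
    rw [GradedRingHom.comp_apply, GradedRingHom.comp_apply, hφ, hφr]
    exact h.symm
  refine le_antisymm ?_ ?_
  · -- `≤`: formal, from `Proj f_k ≫ g = Proj φ_r ≫ Proj f_O`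
    refine le_map_iff_comap_le.mp ?_
    rw [map_ker, ← Proj.map_comp φ fk hφ' hfk',
      Summit.ResolutionOfSingularities.ResolutionOfSingularities.Cruxes.EquisingularLift.StrataSplit.LinearCentre.projMap_congr' hsq
        (HomogeneousIdeal.irrelevant_le_map_comp hφ' hfk') (HomogeneousIdeal.irrelevant_le_map_comp hfO' hφr'),
      Proj.map_comp fO φr hfO' hφr']
    exact Scheme.Hom.le_ker_comp _ _
  · -- `≥`: chartwise on the cover `D₊(φ x_i) = D₊(x_i)` of `ℙ_k`
    have hXO : ∀ i : Fin (N + 1), (X i : MvPolynomial (Fin (N + 1)) O) ∈ (homogeneousSubmodule (Fin (N + 1)) O) 1 :=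
      fun i => isHomogeneous_X O i
    have hXk : ∀ i : Fin (N + 1), φ (X i) ∈ (homogeneousSubmodule (Fin (N + 1)) k) 1 := fun i => φ.map_mem (hXO i)
    let U : Fin (N + 1) → (Proj (homogeneousSubmodule (Fin (N + 1)) k)).affineOpens := fun i =>
      ⟨Proj.basicOpen (homogeneousSubmodule (Fin (N + 1)) k) (φ (X i)),
        Proj.isAffineOpen_basicOpen (homogeneousSubmodule (Fin (N + 1)) k) (φ (X i)) (hXk i) one_pos⟩
    have hU : ⨆ i, (U i : (Proj (homogeneousSubmodule (Fin (N + 1)) k)).Opens) = ⊤ := by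
      have h := Proj.iSup_basicOpen_eq_top (homogeneousSubmodule (Fin (N + 1)) k)
        (fun i : Fin (N + 1) => (X i : MvPolynomial (Fin (N + 1)) k)) (irrelevant_le_span N k)
      have hfun : (fun i => (U i : (Proj (homogeneousSubmodule (Fin (N + 1)) k)).Opens)) =
          fun i => Proj.basicOpen (homogeneousSubmodule (Fin (N + 1)) k) (X i) := by
        funext i
        change Proj.basicOpen (homogeneousSubmodule (Fin (N + 1)) k) (φ (X i)) =
          Proj.basicOpen (homogeneousSubmodule (Fin (N + 1)) k) (X i)
        rw [hφ, map_X]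
      change iSup (fun i => (U i : (Proj (homogeneousSubmodule (Fin (N + 1)) k)).Opens)) = ⊤
      rw [hfun]
      exact h
    refine le_of_iSup_eq_top U hU fun i => ?_
    let UO : (Proj (homogeneousSubmodule (Fin (N + 1)) O)).affineOpens :=
      ⟨Proj.basicOpen (homogeneousSubmodule (Fin (N + 1)) O) (X i),
        Proj.isAffineOpen_basicOpen (homogeneousSubmodule (Fin (N + 1)) O) (X i) (hXO i) one_pos⟩
    have hle : (U i : (Proj (homogeneousSubmodule (Fin (N + 1)) k)).Opens) ≤
        Proj.map φ hφ' ⁻¹ᵁ (UO : (Proj (homogeneousSubmodule (Fin (N + 1)) O)).Opens) := by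
      change Proj.basicOpen (homogeneousSubmodule (Fin (N + 1)) k) (φ (X i)) ≤
        Proj.map φ hφ' ⁻¹ᵁ Proj.basicOpen (homogeneousSubmodule (Fin (N + 1)) O) (X i)
      rw [Proj.map_preimage_basicOpen]
    have hsurjk : Function.Surjective fk :=
      subst_surjective e fk.toRingHom (fun a => hfkC a) (fun j => hfke j)
    have hsurjO : Function.Surjective fO :=
      subst_surjective e fO.toRingHom (fun a => hfOC a) (fun j => hfOe j)
    rw [ker_projMap_ideal_basicOpen fk hfk' hsurjk one_pos (hXk i),
      ideal_comap_of_le (Proj.map φ hφ') (Proj.map fO hfO').ker UO (U i) hle,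
      ker_projMap_ideal_basicOpen fO hfO' hsurjO one_pos (hXO i)]
    -- generators `a / (φ x_i)ⁿ` with `a ∈ ker f_k` homogeneous
    unfold awayIdeal
    rw [Ideal.map_span]
    refine Ideal.span_le.mpr ?_
    rintro _ ⟨x, ⟨n, a, ha, hak, rfl⟩, rfl⟩
    have ha1 : a.IsHomogeneous n := by simpa [smul_eq_mul] using ha
    have hak0 : fk.toRingHom a = 0 := RingHom.mem_ker.mp hak
    obtain ⟨b, hb, hbO, hba⟩ := exists_ker_lift_subst π e fO.toRingHom (fun a => hfOC a) (fun j => hfOe j)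
      fk.toRingHom (fun a => hfkC a) (fun j => hfke j) (fun i hi => hfO1 i hi) (fun i hi => hfkv i hi) hπ a ha1 hak0
    have hbO' : b ∈ RingHom.ker fO := RingHom.mem_ker.mpr hbO
    have hbn : b ∈ (homogeneousSubmodule (Fin (N + 1)) O) (n • 1) := by simpa [smul_eq_mul] using hb
    -- the upstairs section `b / x_iⁿ` lies in the kernel ideal and maps to `a / (φ x_i)ⁿ`
    have hup : (Proj.awayToSection (homogeneousSubmodule (Fin (N + 1)) O) (X i)).hom
          (Away.mk (homogeneousSubmodule (Fin (N + 1)) O) (hXO i) n b hbn) ∈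
        Ideal.map (Proj.awayToSection (homogeneousSubmodule (Fin (N + 1)) O) (X i)).hom
          (awayIdeal (homogeneousSubmodule (Fin (N + 1)) O) (hXO i) (RingHom.ker fO)) :=
      Ideal.mem_map_of_mem _ (mk_mem_awayIdeal (homogeneousSubmodule (Fin (N + 1)) O) (hXO i) hbn hbO')
    have himg : ((Proj.map φ hφ').appLE (UO : (Proj (homogeneousSubmodule (Fin (N + 1)) O)).Opens)
          (U i : (Proj (homogeneousSubmodule (Fin (N + 1)) k)).Opens) hle).hom
          ((Proj.awayToSection (homogeneousSubmodule (Fin (N + 1)) O) (X i)).hom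
            (Away.mk (homogeneousSubmodule (Fin (N + 1)) O) (hXO i) n b hbn)) =
        (Proj.awayToSection (homogeneousSubmodule (Fin (N + 1)) k) (φ (X i))).hom
          (Away.mk (homogeneousSubmodule (Fin (N + 1)) k) (hXk i) n a ha) := by
      have h := congrArg (fun ψ => ψ.hom (Away.mk (homogeneousSubmodule (Fin (N + 1)) O) (hXO i) n b hbn))
        (Proj.awayToSection_comp_appLE φ hφ' (hXO i))
      simp only [CommRingCat.hom_comp, RingHom.comp_apply, CommRingCat.hom_ofHom] at h
      rw [h, Away.map_mk]
      congr 1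
      apply val_injective
      simp only [Away.val_mk]
      congr 1
      rw [hφ, hba]
    rw [SetLike.mem_coe, ← himg]
    exact Ideal.mem_map_of_mem _ hup

include hφ hfOC hfOe hfkC hfke hπ in
/-- `g⁻¹ (supp Λ) = supp Λ_k` for `g = Proj φ` the special fibre of `ℙ^N_O` (R1 `LinearCentre.preimage_support`). [folklore] -/
theorem preimage_support_subst
    (hfO1 : ∀ i : Fin (N + 1), i ∉ Set.range e → (fO (X i) : MvPolynomial (Fin (r + 1)) O).IsHomogeneous 1)
    (hfkv : ∀ i : Fin (N + 1), i ∉ Set.range e → (fk (X i) : MvPolynomial (Fin (r + 1)) k) = MvPolynomial.map π (fO (X i))) :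
    (Proj.map φ hφ') ⁻¹' ((Proj.map fO hfO').ker.support : Set (Proj (homogeneousSubmodule (Fin (N + 1)) O))) =
      ((Proj.map fk hfk').ker.support : Set (Proj (homogeneousSubmodule (Fin (N + 1)) k))) := by
  have h := Scheme.IdealSheafData.support_comap (Proj.map fO hfO').ker (Proj.map φ hφ')
  rw [← ker_projMap_subst_eq_comap π hπ e φ hφ hφ' fO hfO' hfOC hfOe fk hfk' hfkC hfke hfO1 hfkv] at h
  rw [h]
  rfl

end Comap

/-! ## Off the generic point of `Y` -/

section OffGeneric

variable {O k : Type} [CommRing O] [Field k] (π : O →+* k) (hπ : Function.Surjective π) {N r : ℕ}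
  (e : Fin (r + 1) → Fin (N + 1))
  (φ : (homogeneousSubmodule (Fin (N + 1)) O) →+*ᵍ (homogeneousSubmodule (Fin (N + 1)) k))
  (hφ : ∀ q, φ q = MvPolynomial.map π q)
  (hφ' : HomogeneousIdeal.irrelevant (homogeneousSubmodule (Fin (N + 1)) k) ≤
    (HomogeneousIdeal.irrelevant (homogeneousSubmodule (Fin (N + 1)) O)).map φ)
  (fO : (homogeneousSubmodule (Fin (N + 1)) O) →+*ᵍ (homogeneousSubmodule (Fin (r + 1)) O))
  (hfO' : HomogeneousIdeal.irrelevant (homogeneousSubmodule (Fin (r + 1)) O) ≤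
    (HomogeneousIdeal.irrelevant (homogeneousSubmodule (Fin (N + 1)) O)).map fO)
  (hfOC : ∀ a : O, fO (C a) = C a) (hfOe : ∀ j : Fin (r + 1), fO (X (e j)) = X j)
  (fk : (homogeneousSubmodule (Fin (N + 1)) k) →+*ᵍ (homogeneousSubmodule (Fin (r + 1)) k))
  (hfk' : HomogeneousIdeal.irrelevant (homogeneousSubmodule (Fin (r + 1)) k) ≤
    (HomogeneousIdeal.irrelevant (homogeneousSubmodule (Fin (N + 1)) k)).map fk)
  (hfkC : ∀ a : k, fk (C a) = C a) (hfke : ∀ j : Fin (r + 1), fk (X (e j)) = X j)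

include hφ hfOC hfOe hfkC hfke hπ in
/-- **The hyperplane letter is off the generic point of `Y`** (`LetterDatum` clause (l-iv) at the initial stage, `σ = 𝟙`): for an integral
`H` with a closed immersion `ι : H → ℙ^N_k` and `Y = range (ι ≫ g)`, if some point of `H` is off `supp Λ_k` then no point of `supp Λ` is the
generic point of `Y` (R1 `LinearCentre.image_support_subset_nonGeneric`, verbatim). [folklore] -/
theorem image_support_subset_nonGeneric_subst
    (hfO1 : ∀ i : Fin (N + 1), i ∉ Set.range e → (fO (X i) : MvPolynomial (Fin (r + 1)) O).IsHomogeneous 1)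
    (hfkv : ∀ i : Fin (N + 1), i ∉ Set.range e → (fk (X i) : MvPolynomial (Fin (r + 1)) k) = MvPolynomial.map π (fO (X i)))
    {H : Scheme.{0}} [IsIntegral H] (ι : H ⟶ Proj (homogeneousSubmodule (Fin (N + 1)) k)) [IsClosedImmersion ι]
    (hh : ∃ h : H, ι h ∉ ((Proj.map fk hfk').ker.support : Set (Proj (homogeneousSubmodule (Fin (N + 1)) k)))) :
    (𝟙 (Proj (homogeneousSubmodule (Fin (N + 1)) O)) : _ ⟶ _) ''
        ((Proj.map fO hfO').ker.support : Set (Proj (homogeneousSubmodule (Fin (N + 1)) O))) ⊆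
      {x | ¬ IsGenericPoint x (Set.range (ι ≫ Proj.map φ hφ'))} := by
  set g := Proj.map φ hφ' with hg
  have hP := ProjectiveAmbientFibre.isPullback_projMap π φ hφ hπ hφ'
  haveI : IsClosedImmersion (Spec.map (CommRingCat.ofHom π)) := IsClosedImmersion.spec_of_surjective _ hπ
  haveI : IsClosedImmersion g := MorphismProperty.IsStableUnderBaseChange.of_isPullback hP.flip inferInstance
  let f : H ⟶ Proj (homogeneousSubmodule (Fin (N + 1)) O) := ι ≫ g
  have hgenY : IsGenericPoint (f (genericPoint H)) (Set.range f) := by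
    have h := (genericPoint_spec H).image f.continuous
    rwa [Set.image_univ, f.isClosedEmbedding.isClosed_range.closure_eq] at h
  have hgenj : IsGenericPoint (ι (genericPoint H)) (Set.range ι) := by
    have h := (genericPoint_spec H).image ι.continuous
    rwa [Set.image_univ, ι.isClosedEmbedding.isClosed_range.closure_eq] at h
  have hpreC := preimage_support_subst π hπ e φ hφ hφ' fO hfO' hfOC hfOe fk hfk' hfkC hfke hfO1 hfkv
  obtain ⟨a, ha⟩ := hh
  rintro _ ⟨x, hx, rfl⟩ hgx
  change IsGenericPoint x (Set.range f) at hgx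
  have hxe : x = f (genericPoint H) := hgx.eq hgenY
  have hmem : ι (genericPoint H) ∈ g ⁻¹' ((Proj.map fO hfO').ker.support : Set _) := by
    change g (ι (genericPoint H)) ∈ ((Proj.map fO hfO').ker.support : Set _)
    rw [← Scheme.Hom.comp_apply, ← hxe]
    exact hx
  rw [hpreC] at hmem
  apply ha
  have hsub : Set.range ι ⊆ ((Proj.map fk hfk').ker.support : Set _) := by
    rw [← hgenj]
    exact closure_minimal (Set.singleton_subset_iff.mpr hmem) (Proj.map fk hfk').ker.support.isClosed
  exact hsub ⟨a, rfl⟩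

end OffGeneric

end LinearLetter

end Summit.ResolutionOfSingularities.ResolutionOfSingularities.Cruxes.EquisingularLiftNat

end
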